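import Literature.NumberTheory.EllipticCurves.EisensteinWeightOneLatticeLimit
import Literature.NumberTheory.EllipticCurves.EisensteinWeightOneRowIntegral
import HarnessLib

/-!
# The full lattice row of the weight-one Eisenstein series: duplication and the constant term

Topic `Literature/NumberTheory/EllipticCurves`; namespace
`Literature.NumberTheory.EllipticCurves.ModularForms`. Definitions with bodies (`altWeight`,
`fullRow`, `altRow`) and theorems; no named fact.

For `Im w > 0` the **full row** `R₀(w, s) = ∑_{d ∈ ℤ} k(w, s; d)`, `k(w,s;t) = (t+w)^{-1-s}(t+w̄)^{-s}`
(`fullRow`; absolutely convergent for `Re s > 0` only) carries the constant weight `1`, which is NOT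
of mean zero, so the Abel summation of `EisensteinWeightOneRowContinuation.lean` does not apply to
it directly. Two elementary observations replace Poisson summation:

* **duplication** (`fullRow_duplication`): splitting `d` into even and odd,
  `R₀(w, s) = 2^{2s} ( R₀(2w, s) + A(2w, s) )`, `A(w, s) = ∑_d (-1)^d k(w, s; d)` (`altRow`) — and the
  alternating weight `(-1)^d` IS `2`-periodic of mean zero, so `A` is continued and bounded by the
  Abel machinery (`altRow_eq_rowCont`, `norm_altRow_le`); iterating (`fullRow_iterate`),
  `R₀(w, s) = N^{2s} R₀(N w, s) + ∑_{j < K} (2^{j+1})^{2s} A(2^{j+1} w, s)`, `N = 2^K`;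
* **first-order Euler–Maclaurin** (`norm_fullRow_sub_integral_le`): for `Re s > 0`,
  `‖R₀(W, s) - ∫_ℝ k(W, s; t) dt‖ ≤ ½ ∫_ℝ ‖∂ₜk‖ ≤ ½ (1+2‖s‖) e^{2π|Im s|} I(2+2σ) (Im W)^{-1-2σ}`, and
  `∫_ℝ k(W, s; t) dt = -i I₂(s) (Im W)^{-2s}` (`EisensteinWeightOneRowIntegral.lean`), so that
  `N^{2s} R₀(N w, s) → -i I₂(s) (Im w)^{-2s}` as `N = 2^K → ∞` (`tendsto_scaled_fullRow`).

Together (`fullRow_eq_constant_add_tsum`): for `Re s > 0`,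

  **`R₀(w, s) = -i I₂(s) (Im w)^{-2s} + ∑_{j ≥ 0} (2^{j+1})^{2s} A(2^{j+1} w, s)`**,

whose right-hand side is holomorphic on `Re s > -1/2` (next file): the continuation of the full
row, with constant term `-i I₂(s)(Im w)^{-2s} → -iπ` at `s = 0` (Hecke 1927, §2: `φ(y,s)`-term;
Schoeneberg VII §2).

## References

* E. Hecke, *Theorie der Eisensteinschen Reihen höherer Stufe…*, Abh. Math. Sem. Hamburg 5 (1927),
  §2.
* B. Schoeneberg, *Elliptic Modular Functions*, Springer (1974), Ch. VII §2.
-/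

noncomputable section

open Complex Real Set MeasureTheory Filter Finset intervalIntegral
open scoped Topology ComplexConjugate

namespace Literature.NumberTheory.EllipticCurves.ModularForms

/-! ### The objects -/

/-- The alternating weight `(-1)^d` on `ℤ`. [folklore] -/
def altWeight (d : ℤ) : ℂ := if Even d then 1 else -1

/-- **The full row** `R₀(w, s) = ∑_{d ∈ ℤ} k(w, s; d)` (absolutely convergent for `Re s > 0`).
[folklore] -/
def fullRow (w s : ℂ) : ℂ := ∑' d : ℤ, rowKernel w s d

/-- **The alternating row** `A(w, s) = ∑_{d ∈ ℤ} (-1)^d k(w, s; d)` (`rowSum` of the alternating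
weight). [folklore] -/
def altRow (w s : ℂ) : ℂ := rowSum altWeight w s

/-! ### The alternating weight -/

/-- `(-1)^d` on even and odd integers. [folklore] -/
theorem altWeight_of_even {d : ℤ} (h : Even d) : altWeight d = 1 := if_pos h

/-- `(-1)^d = -1` for odd `d`. [folklore] -/
theorem altWeight_of_odd {d : ℤ} (h : Odd d) : altWeight d = -1 :=
  if_neg (Int.not_even_iff_odd.mpr h)

/-- `(-1)^d` is `2`-periodic. [folklore] -/
theorem altWeight_periodic : Function.Periodic altWeight ((2 : ℕ) : ℤ) := by
  intro d
  unfold altWeight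
  have : Even (d + ((2 : ℕ) : ℤ)) ↔ Even d := by
    rw [Int.even_add]
    simp
  simp only [this]

/-- `(-1)^d` has mean zero over a period. [folklore] -/
theorem sum_range_altWeight : ∑ i ∈ Finset.range 2, altWeight i = 0 := by
  rw [Finset.sum_range_succ, Finset.sum_range_succ, Finset.sum_range_zero]
  rw [altWeight_of_even (by simp), altWeight_of_odd (by simp)]
  ring

/-- `‖(-1)^d‖ ≤ 1`. [folklore] -/
theorem norm_altWeight_le (d : ℤ) : ‖altWeight d‖ ≤ 1 := by
  unfold altWeight; split_ifs <;> simp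

/-- `∑_{i mod 2} ‖(-1)^i‖ = 2`. [folklore] -/
theorem sum_range_norm_altWeight : ∑ i ∈ Finset.range 2, ‖altWeight i‖ = 2 := by
  rw [Finset.sum_range_succ, Finset.sum_range_succ, Finset.sum_range_zero]
  rw [altWeight_of_even (by simp), altWeight_of_odd (by simp)]
  simp; norm_num

/-- `1 + (-1)^d` is `2` on even and `0` on odd integers. [folklore] -/
theorem one_add_altWeight (d : ℤ) : 1 + altWeight d = if Even d then 2 else 0 := by
  unfold altWeight; split_ifs <;> norm_num

/-! ### The alternating row is an Abel-continued row -/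

section Alt

variable {w : ℂ} (hw : 0 < w.im)
include hw

/-- **`A(w, s) = R̃(χ_alt, w, s)` for `Re s > 0`** (`rowSum = rowCont` for the `2`-periodic
mean-zero weight). [folklore] -/
theorem altRow_eq_rowCont {s : ℂ} (hs : 0 < s.re) : altRow w s = rowCont 2 altWeight w s :=
  rowSum_eq_rowCont (by norm_num) altWeight_periodic sum_range_altWeight hw hs

/-- **The bound** `‖R̃(χ_alt, w, s)‖ ≤ 160 (1+‖s‖)² e^{2π|Im s|} I(3+2σ) (Im w)^{-2-2σ}` for `Re s > -1`.
[folklore] -/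
theorem norm_rowCont_altWeight_le {s : ℂ} (hs : -1 < s.re) :
    ‖rowCont 2 altWeight w s‖ ≤ 160 * (1 + ‖s‖) ^ 2 * Real.exp (2 * π * |s.im|) *
      (∫ v : ℝ, (1 + v ^ 2) ^ (-(3 + 2 * s.re) / 2)) * w.im ^ (-2 - 2 * s.re) := by
  have h := norm_rowCont_le (by norm_num : 0 < 2) altWeight hw hs
  rw [sum_range_norm_altWeight] at h
  refine h.trans (le_of_eq ?_)
  push_cast
  ring

end Alt

/-! ### Duplication -/

section Duplication

variable {w : ℂ} (hw : 0 < w.im)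
include hw

/-- `Im (N w) = N · Im w > 0`. [folklore] -/
theorem natCast_mul_im_pos {N : ℕ} (hN : 0 < N) : 0 < ((N : ℂ) * w).im := by
  rw [show ((N : ℂ)) = ((N : ℝ) : ℂ) by norm_cast, Complex.im_ofReal_mul]
  exact mul_pos (by exact_mod_cast hN) hw

omit hw in
/-- `Im (N w) = N · Im w`. [folklore] -/
theorem natCast_mul_im (N : ℕ) (w : ℂ) : ((N : ℂ) * w).im = N * w.im := by
  rw [show ((N : ℂ)) = ((N : ℝ) : ℂ) by norm_cast, Complex.im_ofReal_mul]

/-- `k(2w, s; 2δ) = 2^{-1-2s} k(w, s; δ)`. [folklore] -/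
theorem rowKernel_two_mul (s : ℂ) (δ : ℤ) :
    rowKernel (2 * w) s ((2 * δ : ℤ) : ℝ) = (2 : ℂ) ^ (-1 - 2 * s) * rowKernel w s δ := by
  have h := rowKernel_class_eq (P := 2) (by norm_num) (w := 2 * w)
    (natCast_mul_im_pos hw (N := 2) (by norm_num)) s 0 δ
  simp only [Int.cast_zero, add_zero, zero_add, Nat.cast_ofNat] at h
  rw [show (2 * w) / 2 = w by ring] at h
  exact_mod_cast h

/-- Summability of the full row for `Re s > 0`. [folklore] -/
theorem summable_fullRow {s : ℂ} (hs : 0 < s.re) : Summable fun d : ℤ ↦ rowKernel w s d :=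
  (summable_norm_rowKernel_int hw hs).of_norm

/-- **Duplication**: `R₀(2w, s) + A(2w, s) = 2^{-2s} R₀(w, s)` (`Re s > 0`). [folklore] -/
theorem fullRow_add_altRow_two_mul {s : ℂ} (hs : 0 < s.re) :
    fullRow (2 * w) s + altRow (2 * w) s = (2 : ℂ) ^ (-2 * s) * fullRow w s := by
  have hw2 : 0 < (2 * w).im := by
    have := natCast_mul_im_pos hw (N := 2) (by norm_num); simpa using this
  have hF : Summable fun d : ℤ ↦ (1 + altWeight d) * rowKernel (2 * w) s d := by
    have h1 := summable_fullRow hw2 hs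
    have h2 : Summable fun d : ℤ ↦ altWeight d * rowKernel (2 * w) s d :=
      (summable_norm_mul_rowKernel_int hw2 norm_altWeight_le hs).of_norm
    simpa [add_mul] using h1.add h2
  -- the left side as one `ℤ`-series
  have hL : fullRow (2 * w) s + altRow (2 * w) s =
      ∑' d : ℤ, (1 + altWeight d) * rowKernel (2 * w) s d := by
    unfold fullRow altRow rowSum
    rw [← (summable_fullRow hw2 hs).tsum_add
      ((summable_norm_mul_rowKernel_int hw2 norm_altWeight_le hs).of_norm)]
    exact tsum_congr fun d ↦ by ring
  rw [hL, tsum_int_eq_sum_tsum_classes (P := 2) (by norm_num) hF, Fin.sum_univ_two]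
  simp only [Fin.val_zero, Fin.val_one, Nat.cast_zero, Nat.cast_one, zero_add, Nat.cast_ofNat]
  -- odd class vanishes, even class is `2 · 2^{-1-2s} R₀(w)`
  have hodd : ∀ δ : ℤ, (1 + altWeight (1 + 2 * δ)) * rowKernel (2 * w) s ((1 + 2 * δ : ℤ) : ℝ) = 0 := by
    intro δ
    rw [one_add_altWeight, if_neg (by rw [Int.not_even_iff_odd]; exact ⟨δ, by ring⟩)]
    ring
  have heven : ∀ δ : ℤ, (1 + altWeight (2 * δ)) * rowKernel (2 * w) s ((2 * δ : ℤ) : ℝ) =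
      (2 * (2 : ℂ) ^ (-1 - 2 * s)) * rowKernel w s δ := by
    intro δ
    rw [one_add_altWeight, if_pos ⟨δ, by ring⟩, rowKernel_two_mul hw s δ]
    ring
  simp only [Int.cast_add, Int.cast_one, Int.cast_mul, Int.cast_ofNat] at hodd heven ⊢
  simp_rw [hodd, heven]
  rw [tsum_zero, add_zero, tsum_mul_left]
  unfold fullRow
  have h2 : (2 : ℂ) ≠ 0 := two_ne_zero
  rw [show (-1 - 2 * s) = (-1 : ℂ) + (-2 * s) by ring, cpow_add _ _ h2, cpow_neg_one]
  field_simp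

/-- **`R₀(w, s) = 2^{2s} (R₀(2w, s) + A(2w, s))`** (`Re s > 0`). [folklore] -/
theorem fullRow_duplication {s : ℂ} (hs : 0 < s.re) :
    fullRow w s = (2 : ℂ) ^ (2 * s) * (fullRow (2 * w) s + altRow (2 * w) s) := by
  rw [fullRow_add_altRow_two_mul hw hs, ← mul_assoc, ← cpow_add _ _ two_ne_zero,
    show 2 * s + -2 * s = 0 by ring, cpow_zero, one_mul]

end Duplication

/-! ### Iterated duplication -/

/-- **`R₀(w, s) = (2^K)^{2s} R₀(2^K w, s) + ∑_{j < K} (2^{j+1})^{2s} A(2^{j+1} w, s)`** (`Re s > 0`).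
[folklore] -/
theorem fullRow_iterate {w : ℂ} (hw : 0 < w.im) {s : ℂ} (hs : 0 < s.re) (K : ℕ) :
    fullRow w s = ((2 ^ K : ℕ) : ℂ) ^ (2 * s) * fullRow ((2 ^ K : ℕ) * w) s +
      ∑ j ∈ Finset.range K, ((2 ^ (j + 1) : ℕ) : ℂ) ^ (2 * s) * altRow ((2 ^ (j + 1) : ℕ) * w) s := by
  induction K with
  | zero => simp
  | succ K ih =>
    have hwK : 0 < (((2 ^ K : ℕ) : ℂ) * w).im := natCast_mul_im_pos hw (Nat.pos_of_ne_zero (by positivity))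
    rw [ih, Finset.sum_range_succ, fullRow_duplication hwK hs]
    have e1 : (2 : ℂ) * (((2 ^ K : ℕ) : ℂ) * w) = ((2 ^ (K + 1) : ℕ) : ℂ) * w := by
      push_cast; ring
    have e2 : ((2 ^ K : ℕ) : ℂ) ^ (2 * s) * (2 : ℂ) ^ (2 * s) = ((2 ^ (K + 1) : ℕ) : ℂ) ^ (2 * s) := by
      have hz : ((2 ^ K : ℕ) : ℂ) ≠ 0 := by exact_mod_cast pow_ne_zero K two_ne_zero
      rw [show (((2 ^ (K + 1) : ℕ)) : ℂ) = ((2 : ℕ) : ℂ) * ((2 ^ K : ℕ) : ℂ) by push_cast; ring,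
        natCast_mul_cpow_of_pos (by norm_num) hz]
      push_cast
      ring
    rw [e1]
    linear_combination (fullRow (((2 ^ (K + 1) : ℕ) : ℂ) * w) s +
      altRow (((2 ^ (K + 1) : ℕ) : ℂ) * w) s) * e2

/-! ### First-order Euler–Maclaurin for the full row -/

section EulerMaclaurin

variable {w : ℂ} (hw : 0 < w.im)
include hw

/-- Integrability of `k(w, s; ·)` on `ℝ` for `Re s > 0`. [folklore] -/
theorem integrable_rowKernel {s : ℂ} (hs : 0 < s.re) : Integrable (rowKernel w s) := by
  refine Integrable.mono' ((integrable_norm_ofReal_add_rpow_neg hw (a := 1 + 2 * s.re)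
    (by linarith)).const_mul (Real.exp (2 * π * |s.im|)))
    (continuous_iff_continuousAt.mpr fun t ↦
      (hasDerivAt_rowKernel hw s t).continuousAt).aestronglyMeasurable ?_
  refine Eventually.of_forall fun t ↦ ?_
  have := norm_rowKernel_le hw s t
  rwa [show -1 - 2 * s.re = -(1 + 2 * s.re) by ring] at this

/-- Integrability of `∂ₜk(w, s; ·)` on `ℝ` for `Re s > -1/2`. [folklore] -/
theorem integrable_rowKernel₁ {s : ℂ} (hs : -1 / 2 < s.re) : Integrable (rowKernel₁ w s) := by
  refine Integrable.mono' ((integrable_norm_ofReal_add_rpow_neg hw (a := 2 + 2 * s.re)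
    (by linarith)).const_mul ((1 + 2 * ‖s‖) * Real.exp (2 * π * |s.im|)))
    (continuous_rowKernel₁ hw s).aestronglyMeasurable ?_
  refine Eventually.of_forall fun t ↦ ?_
  have := norm_rowKernel₁_le hw s t
  rwa [show -2 - 2 * s.re = -(2 + 2 * s.re) by ring] at this

/-- **`∫_ℝ ‖∂ₜk‖ ≤ (1+2‖s‖) e^{2π|Im s|} I(2+2σ) (Im w)^{-1-2σ}`** (`Re s > -1/2`). [folklore] -/
theorem integral_norm_rowKernel₁_le {s : ℂ} (hs : -1 / 2 < s.re) :
    ∫ t : ℝ, ‖rowKernel₁ w s t‖ ≤ (1 + 2 * ‖s‖) * Real.exp (2 * π * |s.im|) *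
      (∫ v : ℝ, (1 + v ^ 2) ^ (-(2 + 2 * s.re) / 2)) * w.im ^ (-1 - 2 * s.re) := by
  have hη : 0 < w.im := hw
  have h1 : ∫ t : ℝ, ‖rowKernel₁ w s t‖ ≤
      ∫ t : ℝ, (1 + 2 * ‖s‖) * Real.exp (2 * π * |s.im|) * ‖(t : ℂ) + w‖ ^ (-(2 + 2 * s.re)) := by
    refine integral_mono_of_nonneg (Eventually.of_forall fun t ↦ norm_nonneg _)
      ((integrable_norm_ofReal_add_rpow_neg hw (a := 2 + 2 * s.re) (by linarith)).const_mul _)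
      (Eventually.of_forall fun t ↦ ?_)
    have := norm_rowKernel₁_le hw s t
    rwa [show -2 - 2 * s.re = -(2 + 2 * s.re) by ring] at this
  refine h1.trans (le_of_eq ?_)
  rw [MeasureTheory.integral_const_mul, integral_norm_ofReal_add_rpow_neg hw (2 + 2 * s.re),
    show (1 - (2 + 2 * s.re)) = -1 - 2 * s.re by ring]
  ring

/-- **Euler–Maclaurin on one interval**:
`∫_{d-1}^{d} (t - d + ½) ∂ₜk(t) dt = ½ (k(d) + k(d-1)) - ∫_{d-1}^{d} k(t) dt`. [folklore] -/
theorem intervalIntegral_sawtooth_mul_rowKernel₁ (s : ℂ) (d : ℤ) :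
    ∫ t in ((d : ℝ) - 1)..d, ((t : ℂ) - d + 1 / 2) * rowKernel₁ w s t =
      1 / 2 * (rowKernel w s d + rowKernel w s ((d : ℝ) - 1)) -
        ∫ t in ((d : ℝ) - 1)..d, rowKernel w s t := by
  have hu : ∀ t ∈ uIcc ((d : ℝ) - 1) d, HasDerivAt (fun t : ℝ ↦ (t : ℂ) - d + 1 / 2) 1 t := by
    intro t _
    have h := ((hasDerivAt_id t).ofReal_comp).sub_const ((d : ℂ)) |>.add_const (1 / 2 : ℂ)
    simpa using h
  have hv : ∀ t ∈ uIcc ((d : ℝ) - 1) d, HasDerivAt (rowKernel w s) (rowKernel₁ w s t) t :=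
    fun t _ ↦ hasDerivAt_rowKernel hw s t
  have hu' : IntervalIntegrable (fun _ : ℝ ↦ (1 : ℂ)) volume ((d : ℝ) - 1) d :=
    intervalIntegrable_const
  have hv' : IntervalIntegrable (rowKernel₁ w s) volume ((d : ℝ) - 1) d :=
    (continuous_rowKernel₁ hw s).intervalIntegrable _ _
  rw [intervalIntegral.integral_mul_deriv_eq_deriv_mul hu hv hu' hv']
  simp only [one_mul]
  push_cast
  ring

/-- The per-interval bound `‖∫_{d-1}^{d} (t - d + ½) ∂ₜk‖ ≤ ∫_{d-1}^{d} ½‖∂ₜk‖`. [folklore] -/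
theorem norm_intervalIntegral_sawtooth_le (s : ℂ) (d : ℤ) :
    ‖∫ t in ((d : ℝ) - 1)..d, ((t : ℂ) - d + 1 / 2) * rowKernel₁ w s t‖ ≤
      ∫ t in ((d : ℝ) - 1)..d, 1 / 2 * ‖rowKernel₁ w s t‖ := by
  refine intervalIntegral.norm_integral_le_of_norm_le (by linarith) ?_
    ((continuous_const.mul (continuous_rowKernel₁ hw s).norm).intervalIntegrable _ _)
  refine Eventually.of_forall fun t ht ↦ ?_
  rw [norm_mul]
  refine mul_le_mul_of_nonneg_right ?_ (norm_nonneg _)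
  have h1 : ((t : ℂ) - d + 1 / 2) = (((t - d + 1 / 2 : ℝ)) : ℂ) := by push_cast; ring
  rw [h1, Complex.norm_real, Real.norm_eq_abs, abs_le]
  constructor <;> linarith [ht.1, ht.2]

/-- **First-order Euler–Maclaurin for the full row** (`Re s > 0`):
`‖R₀(w, s) - ∫_ℝ k(w, s; t) dt‖ ≤ ½ ∫_ℝ ‖∂ₜk‖`. [folklore] -/
theorem norm_fullRow_sub_integral_le' {s : ℂ} (hs : 0 < s.re) :
    ‖fullRow w s - ∫ t : ℝ, rowKernel w s t‖ ≤ 1 / 2 * ∫ t : ℝ, ‖rowKernel₁ w s t‖ := by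
  have hk := integrable_rowKernel hw hs
  have hk₁ := integrable_rowKernel₁ hw (by linarith : -1 / 2 < s.re)
  -- the three `ℤ`-indexed series
  have hA : HasSum (fun d : ℤ ↦ ∫ t in ((d : ℝ) - 1)..d, rowKernel w s t) (∫ t, rowKernel w s t) :=
    hasSum_intervalIntegral_int hk
  have hS := summable_fullRow hw hs
  have hB : HasSum (fun d : ℤ ↦ 1 / 2 * (rowKernel w s d + rowKernel w s ((d : ℝ) - 1)))
      (fullRow w s) := by
    have h1 : HasSum (fun d : ℤ ↦ rowKernel w s d) (fullRow w s) := hS.hasSum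
    have h2 : HasSum (fun d : ℤ ↦ rowKernel w s ((d : ℝ) - 1)) (fullRow w s) := by
      have := (Equiv.subRight (1 : ℤ)).hasSum_iff.mpr h1
      refine this.congr_fun fun d ↦ ?_
      simp [Equiv.subRight]
    have h := (h1.add h2).mul_left (1 / 2 : ℂ)
    rw [show (1 / 2 : ℂ) * (fullRow w s + fullRow w s) = fullRow w s by ring] at h
    exact h
  have hC : HasSum (fun d : ℤ ↦ ∫ t in ((d : ℝ) - 1)..d, 1 / 2 * ‖rowKernel₁ w s t‖)
      (∫ t, 1 / 2 * ‖rowKernel₁ w s t‖) :=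
    hasSum_intervalIntegral_int (hk₁.norm.const_mul _)
  -- the difference as a series of sawtooth integrals
  have hdiff : HasSum (fun d : ℤ ↦ ∫ t in ((d : ℝ) - 1)..d, ((t : ℂ) - d + 1 / 2) * rowKernel₁ w s t)
      (fullRow w s - ∫ t, rowKernel w s t) := by
    have h := hB.sub hA
    refine h.congr_fun fun d ↦ ?_
    exact intervalIntegral_sawtooth_mul_rowKernel₁ hw s d
  rw [← hdiff.tsum_eq]
  have hsumm : Summable fun d : ℤ ↦ ∫ t in ((d : ℝ) - 1)..d, 1 / 2 * ‖rowKernel₁ w s t‖ :=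
    hC.summable
  calc ‖∑' d : ℤ, ∫ t in ((d : ℝ) - 1)..d, ((t : ℂ) - d + 1 / 2) * rowKernel₁ w s t‖
      ≤ ∑' d : ℤ, ‖∫ t in ((d : ℝ) - 1)..d, ((t : ℂ) - d + 1 / 2) * rowKernel₁ w s t‖ :=
        norm_tsum_le_tsum_norm (Summable.of_nonneg_of_le (fun _ ↦ norm_nonneg _)
          (fun d ↦ norm_intervalIntegral_sawtooth_le hw s d) hsumm)
    _ ≤ ∑' d : ℤ, ∫ t in ((d : ℝ) - 1)..d, 1 / 2 * ‖rowKernel₁ w s t‖ :=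
        (Summable.of_nonneg_of_le (fun _ ↦ norm_nonneg _)
          (fun d ↦ norm_intervalIntegral_sawtooth_le hw s d) hsumm).tsum_le_tsum
          (fun d ↦ norm_intervalIntegral_sawtooth_le hw s d) hsumm
    _ = 1 / 2 * ∫ t, ‖rowKernel₁ w s t‖ := by rw [hC.tsum_eq, MeasureTheory.integral_const_mul]

/-- **`‖R₀(w, s) - ∫_ℝ k‖ ≤ ½ (1+2‖s‖) e^{2π|Im s|} I(2+2σ) (Im w)^{-1-2σ}`** (`Re s > 0`). [folklore] -/
theorem norm_fullRow_sub_integral_le {s : ℂ} (hs : 0 < s.re) :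
    ‖fullRow w s - ∫ t : ℝ, rowKernel w s t‖ ≤ 1 / 2 * ((1 + 2 * ‖s‖) * Real.exp (2 * π * |s.im|) *
      (∫ v : ℝ, (1 + v ^ 2) ^ (-(2 + 2 * s.re) / 2)) * w.im ^ (-1 - 2 * s.re)) :=
  (norm_fullRow_sub_integral_le' hw hs).trans (mul_le_mul_of_nonneg_left
    (integral_norm_rowKernel₁_le hw (by linarith)) (by norm_num))

end EulerMaclaurin

/-! ### The limit of the scaled full rows -/

section Limit

variable {w : ℂ} (hw : 0 < w.im)
include hw

/-- `(N)^{2s} (N η)^{-2s} = η^{-2s}` for a positive integer `N` and `η > 0`. [folklore] -/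
theorem natCast_cpow_mul_cpow_neg {N : ℕ} (hN : 0 < N) (s : ℂ) :
    ((N : ℂ)) ^ (2 * s) * ((((N : ℝ) * w.im : ℝ)) : ℂ) ^ (-2 * s) = ((w.im : ℝ) : ℂ) ^ (-2 * s) := by
  have hη0 : ((w.im : ℝ) : ℂ) ≠ 0 := by exact_mod_cast hw.ne'
  have hN0 : ((N : ℂ)) ≠ 0 := by exact_mod_cast hN.ne'
  rw [show ((((N : ℝ) * w.im : ℝ)) : ℂ) = (N : ℂ) * ((w.im : ℝ) : ℂ) by push_cast; ring,
    natCast_mul_cpow_of_pos hN hη0, ← mul_assoc, ← cpow_add _ _ hN0,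
    show 2 * s + -2 * s = 0 by ring, cpow_zero, one_mul]

/-- **`(2^K)^{2s} R₀(2^K w, s) → -i I₂(s) (Im w)^{-2s}`** as `K → ∞` (`Re s > 0`). [folklore] -/
theorem tendsto_scaled_fullRow {s : ℂ} (hs : 0 < s.re) :
    Tendsto (fun K : ℕ ↦ ((2 ^ K : ℕ) : ℂ) ^ (2 * s) * fullRow ((2 ^ K : ℕ) * w) s) atTop
      (𝓝 (-I * constIntegral s * ((w.im : ℝ) : ℂ) ^ (-2 * s))) := by
  have hη : 0 < w.im := hw
  set C : ℝ := 1 / 2 * ((1 + 2 * ‖s‖) * Real.exp (2 * π * |s.im|) *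
    (∫ v : ℝ, (1 + v ^ 2) ^ (-(2 + 2 * s.re) / 2))) with hC
  have hC0 : 0 ≤ C := by
    rw [hC]
    have : 0 ≤ ∫ v : ℝ, (1 + v ^ 2) ^ (-(2 + 2 * s.re) / 2) :=
      integral_nonneg fun v ↦ Real.rpow_nonneg (by positivity) _
    positivity
  rw [tendsto_iff_norm_sub_tendsto_zero]
  -- the error at step `K` is at most `C η^{-1-2σ} 2^{-K}`
  have hbound : ∀ K : ℕ, ‖((2 ^ K : ℕ) : ℂ) ^ (2 * s) * fullRow ((2 ^ K : ℕ) * w) s -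
      -I * constIntegral s * ((w.im : ℝ) : ℂ) ^ (-2 * s)‖ ≤
        C * w.im ^ (-1 - 2 * s.re) * ((2 : ℝ) ^ K)⁻¹ := by
    intro K
    set N : ℕ := 2 ^ K with hN
    have hNpos : 0 < N := by rw [hN]; positivity
    have hNr : (0 : ℝ) < N := by exact_mod_cast hNpos
    have hW : 0 < (((N : ℂ)) * w).im := natCast_mul_im_pos hw hNpos
    have hWim : (((N : ℂ)) * w).im = N * w.im := natCast_mul_im N w
    -- `R₀(Nw) = -i I₂ (Nη)^{-2s} + E`
    have hE := norm_fullRow_sub_integral_le hW hs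
    rw [integral_rowKernel_eq_constIntegral hW hs, hWim] at hE
    have hkey : ((N : ℂ)) ^ (2 * s) * fullRow ((N : ℂ) * w) s -
        -I * constIntegral s * ((w.im : ℝ) : ℂ) ^ (-2 * s) =
        ((N : ℂ)) ^ (2 * s) * (fullRow ((N : ℂ) * w) s -
          -I * constIntegral s * ((((N : ℝ) * w.im : ℝ)) : ℂ) ^ (-2 * s)) := by
      rw [mul_sub, show ((N : ℂ)) ^ (2 * s) * (-I * constIntegral s *
          ((((N : ℝ) * w.im : ℝ)) : ℂ) ^ (-2 * s)) = -I * constIntegral s *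
          (((N : ℂ)) ^ (2 * s) * ((((N : ℝ) * w.im : ℝ)) : ℂ) ^ (-2 * s)) by ring,
        natCast_cpow_mul_cpow_neg hw hNpos]
    rw [hkey, norm_mul, Complex.norm_natCast_cpow_of_pos hNpos]
    simp only [Complex.mul_re, Complex.re_ofNat, Complex.im_ofNat, zero_mul, sub_zero]
    have hNpow : ((N : ℝ)) ^ (2 * s.re) * ((N : ℝ) * w.im) ^ (-1 - 2 * s.re) =
        w.im ^ (-1 - 2 * s.re) * ((2 : ℝ) ^ K)⁻¹ := by
      rw [Real.mul_rpow hNr.le hη.le, ← mul_assoc, ← Real.rpow_add hNr,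
        show 2 * s.re + (-1 - 2 * s.re) = -1 by ring, Real.rpow_neg_one, hN]
      push_cast
      ring
    calc ((N : ℝ)) ^ (2 * s.re) * ‖fullRow ((N : ℂ) * w) s -
          -I * constIntegral s * ((((N : ℝ) * w.im : ℝ)) : ℂ) ^ (-2 * s)‖
        ≤ ((N : ℝ)) ^ (2 * s.re) * (C * ((N : ℝ) * w.im) ^ (-1 - 2 * s.re)) := by
          refine mul_le_mul_of_nonneg_left ?_ (Real.rpow_nonneg hNr.le _)
          rw [hC]; linarith [hE]
      _ = C * w.im ^ (-1 - 2 * s.re) * ((2 : ℝ) ^ K)⁻¹ := by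
          rw [show ((N : ℝ)) ^ (2 * s.re) * (C * ((N : ℝ) * w.im) ^ (-1 - 2 * s.re)) =
            C * (((N : ℝ)) ^ (2 * s.re) * ((N : ℝ) * w.im) ^ (-1 - 2 * s.re)) by ring, hNpow]
          ring
  have hgeom : Tendsto (fun K : ℕ ↦ C * w.im ^ (-1 - 2 * s.re) * ((2 : ℝ) ^ K)⁻¹) atTop (𝓝 0) := by
    have h := (tendsto_inv_atTop_zero.comp (tendsto_pow_atTop_atTop_of_one_lt one_lt_two)).const_mul
      (C * w.im ^ (-1 - 2 * s.re))
    simpa using h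
  exact squeeze_zero (fun K ↦ norm_nonneg _) hbound hgeom

end Limit

/-! ### The full row as constant term plus a geometric series of alternating rows -/

section Main

variable {w : ℂ} (hw : 0 < w.im)
include hw

/-- The terms `(2^{j+1})^{2s} A(2^{j+1} w, s)` are bounded by `C(s) (Im w)^{-2-2σ} 4^{-(j+1)}`
(`Re s > 0`). [folklore] -/
theorem norm_scaled_altRow_le {s : ℂ} (hs : 0 < s.re) (j : ℕ) :
    ‖((2 ^ (j + 1) : ℕ) : ℂ) ^ (2 * s) * altRow ((2 ^ (j + 1) : ℕ) * w) s‖ ≤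
      160 * (1 + ‖s‖) ^ 2 * Real.exp (2 * π * |s.im|) *
        (∫ v : ℝ, (1 + v ^ 2) ^ (-(3 + 2 * s.re) / 2)) * w.im ^ (-2 - 2 * s.re) *
          (((2 : ℝ) ^ (j + 1)) ^ 2)⁻¹ := by
  have hη : 0 < w.im := hw
  set N : ℕ := 2 ^ (j + 1) with hN
  have hNpos : 0 < N := by rw [hN]; positivity
  have hNr : (0 : ℝ) < N := by exact_mod_cast hNpos
  have hW : 0 < (((N : ℂ)) * w).im := natCast_mul_im_pos hw hNpos
  have hWim : (((N : ℂ)) * w).im = N * w.im := natCast_mul_im N w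
  rw [norm_mul, Complex.norm_natCast_cpow_of_pos hNpos, altRow_eq_rowCont hW hs]
  simp only [Complex.mul_re, Complex.re_ofNat, Complex.im_ofNat, zero_mul, sub_zero]
  have h := norm_rowCont_altWeight_le hW (by linarith : -1 < s.re)
  rw [hWim] at h
  set D : ℝ := 160 * (1 + ‖s‖) ^ 2 * Real.exp (2 * π * |s.im|) *
    (∫ v : ℝ, (1 + v ^ 2) ^ (-(3 + 2 * s.re) / 2)) with hD
  have hD0 : 0 ≤ D := by
    rw [hD]
    have : 0 ≤ ∫ v : ℝ, (1 + v ^ 2) ^ (-(3 + 2 * s.re) / 2) :=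
      integral_nonneg fun v ↦ Real.rpow_nonneg (by positivity) _
    positivity
  have hNpow : ((N : ℝ)) ^ (2 * s.re) * ((N : ℝ) * w.im) ^ (-2 - 2 * s.re) =
      w.im ^ (-2 - 2 * s.re) * (((2 : ℝ) ^ (j + 1)) ^ 2)⁻¹ := by
    rw [Real.mul_rpow hNr.le hη.le, ← mul_assoc, ← Real.rpow_add hNr,
      show 2 * s.re + (-2 - 2 * s.re) = -2 by ring, Real.rpow_neg hNr.le, Real.rpow_two, hN]
    push_cast
    ring
  calc ((N : ℝ)) ^ (2 * s.re) * ‖rowCont 2 altWeight ((N : ℂ) * w) s‖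
      ≤ ((N : ℝ)) ^ (2 * s.re) * (D * ((N : ℝ) * w.im) ^ (-2 - 2 * s.re)) :=
        mul_le_mul_of_nonneg_left (by rw [hD]; exact h) (Real.rpow_nonneg hNr.le _)
    _ = D * w.im ^ (-2 - 2 * s.re) * (((2 : ℝ) ^ (j + 1)) ^ 2)⁻¹ := by
        rw [show ((N : ℝ)) ^ (2 * s.re) * (D * ((N : ℝ) * w.im) ^ (-2 - 2 * s.re)) =
          D * (((N : ℝ)) ^ (2 * s.re) * ((N : ℝ) * w.im) ^ (-2 - 2 * s.re)) by ring, hNpow]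
        ring

/-- Summability of the scaled alternating rows (`Re s > 0`). [folklore] -/
theorem summable_scaled_altRow {s : ℂ} (hs : 0 < s.re) :
    Summable fun j : ℕ ↦ ((2 ^ (j + 1) : ℕ) : ℂ) ^ (2 * s) * altRow ((2 ^ (j + 1) : ℕ) * w) s := by
  refine Summable.of_norm_bounded (g := fun j : ℕ ↦ 160 * (1 + ‖s‖) ^ 2 * Real.exp (2 * π * |s.im|) *
      (∫ v : ℝ, (1 + v ^ 2) ^ (-(3 + 2 * s.re) / 2)) * w.im ^ (-2 - 2 * s.re) *
        (((2 : ℝ) ^ (j + 1)) ^ 2)⁻¹) ?_ (fun j ↦ norm_scaled_altRow_le hw hs j)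
  refine Summable.mul_left _ ?_
  have h : Summable fun j : ℕ ↦ ((4 : ℝ)⁻¹) ^ j :=
    summable_geometric_of_lt_one (by norm_num) (by norm_num)
  refine (h.mul_left (4 : ℝ)⁻¹).congr fun j ↦ ?_
  rw [← pow_succ', ← pow_mul, mul_comm (j + 1) 2, pow_mul, inv_pow]
  norm_num

/-- **The full row as constant term plus alternating rows** (`Re s > 0`):
`R₀(w, s) = -i I₂(s) (Im w)^{-2s} + ∑_{j ≥ 0} (2^{j+1})^{2s} A(2^{j+1} w, s)`. [folklore] -/
theorem fullRow_eq_constant_add_tsum {s : ℂ} (hs : 0 < s.re) :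
    fullRow w s = -I * constIntegral s * ((w.im : ℝ) : ℂ) ^ (-2 * s) +
      ∑' j : ℕ, ((2 ^ (j + 1) : ℕ) : ℂ) ^ (2 * s) * altRow ((2 ^ (j + 1) : ℕ) * w) s := by
  have hsum := summable_scaled_altRow hw hs
  -- partial sums tend to the series, scaled rows tend to the constant term
  have hS := hsum.hasSum.tendsto_sum_nat
  have hT := tendsto_scaled_fullRow hw hs
  have hboth := hT.add hS
  have hconst : Tendsto (fun _ : ℕ ↦ fullRow w s) atTop (𝓝 (fullRow w s)) := tendsto_const_nhds
  have heq : (fun K : ℕ ↦ ((2 ^ K : ℕ) : ℂ) ^ (2 * s) * fullRow ((2 ^ K : ℕ) * w) s +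
      ∑ j ∈ Finset.range K, ((2 ^ (j + 1) : ℕ) : ℂ) ^ (2 * s) * altRow ((2 ^ (j + 1) : ℕ) * w) s) =
      fun _ ↦ fullRow w s := by
    funext K
    exact (fullRow_iterate hw hs K).symm
  rw [heq] at hboth
  exact tendsto_nhds_unique hconst hboth

end Main

end Literature.NumberTheory.EllipticCurves.ModularForms
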